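import Literature.MathematicalPhysics.QuantumFieldTheory.Balaban1983to89.B12RegularSpaces111Mono
import Literature.MathematicalPhysics.QuantumFieldTheory.Balaban1983to89.B12Eq18Current
import Literature.MathematicalPhysics.QuantumFieldTheory.Balaban1983to89.B12Eq117Membership

/-!
# `Balaban1983to89.B12Eq117Concrete` — T. Bałaban, *Renormalization group approach to lattice gauge field theories. I*,
Commun. Math. Phys. **109** (1987) 249–301 [Balaban1987RG1]: **(1.17) p. 263 and its membership paragraph ON THE CONCRETE
SPACES `U^c_j(X, α₀, α₁, γ₀)` of `B12RegularSpaces111`** — the upgrade of the gen-1 SCHEMA `B12Eq117Membership` (there: an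
abstract membership model at fixed `X`, `j` with deviation functionals; here: the conditions (i)–(iv), the (iv)-data `Frame.bg`
(the functions `U_n(M˙(·))`, `J_n(M˙(·))` of (1.15)) and the space as the union of orbits, all of record), INCLUDING the two
sentences the schema left untyped: the specialisation `𝐉 = D^{ξ*}_𝐔 ξ⁻²π Im ∂𝐔` with the concrete current (1.8) of
`B12Eq18Current`.

HONEST FRAMING (cell `lit-balaban`, verbatim): statement-level skeleton of published theorems with citation tags; proofs where landed; nothing here is a claim about the Yang–Mills mass gap.

PDF held: `paper:balaban1987-cmp109-rg-i-small-field` (journal page = PDF page + 248); p. 263 re-read as an image from the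
render `b2b-balaban-ref1/pages/1987-cmp109-rg-I-small-field/1987-cmp109-rg-I-small-field-p015-x2.png` by this unit.

THE PRINT, verbatim (p. 263).  *«At first we show that there are some simple and natural spaces contained in U^c_j(X, α₀, α₁).
Let us take the space of configurations (𝐔, 𝐉) satisfying the conditions (i)–(iii) with constants α₀′, α₁′ instead of α₀,
α₁. We assume that the constants α₀′, α₁′ are smaller than α₀, α₁ correspondingly, then obviously these three conditions are
satisfied in the original formulation. Now consider the functions U_n(M˙(𝐔)). We have M˙(𝐔) = Ū^p on Λ_p, |∂Ū^p − 1| <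
2α₀′(L^pξ)². From Proposition 9 [15] we obtain  |∂U_n(M˙(𝐔)) − 1| < B₃2α₀′L^{−2n}(L^nξ)² = 2B₃α₀′ξ²,  |J_n(M˙(𝐔))| <
B₃2α₀′(L^nξ)²  on X̃^{−2}. (1.17)  It is obvious that for α₀′ sufficiently small the above estimates imply the condition (iv),
thus the configuration (𝐔, 𝐉) belongs to the space U^c_j(X, α₀, α₁). We specialize this example even more and consider
configurations satisfying (i)–(iii) with α₀′, α₁′ as above, and such that 𝐉 = D^{ξ*}_𝐔 ξ⁻²π Im ∂𝐔 satisfies the bound |𝐉| < α₀′,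
similarly the configuration constructed for U instead of 𝐔. Then the pairs (𝐔, 𝐉) belong to U^c_j(X, α₀, α₁). In particular
the minimal configurations U_j satisfying the bound |∂U_j − 1| < ε₀ξ² with ε₀ sufficiently small, satisfy the above
conditions.»*  And p. 262 (iv): *«… This pair satisfies the bounds |∂U_n(M˙(𝐔)) − 1| < α₀ξ², |J_n(M˙(𝐔))| < α₀(Lⁿξ)² on X̃⁻², (1.16)
and the same bounds hold for U instead of 𝐔.»*

THE TYPING (carriers of record, nothing re-declared).  The output (1.17) of Proposition 9 [15] (row B11.Prop9; the
constructions `M˙`, `U_n`, `J_n` are the DATA `Frame.bg` of `B12RegularSpaces111`) enters as a HYPOTHESIS SHAPE on the (iv)-data,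
quantified over the configurations `V` to which the print applies it — those with `|∂V − 1| < α₀′ξ²` on `X` (for `𝐔` by (iii),
«and the same bounds hold for U» by (1.11)): `∀ V, (∀ p ⊂ X, |∂V(p) − 1| < α₀′ξ²) → ∀ n = 1..j, |∂U_n(M˙(V)) − 1| <
B₃2α₀′L^{−2n}(Lⁿξ)² ∧ |J_n(M˙(V))| < B₃2α₀′(Lⁿξ)² on X̃⁻²` — spelled exactly as printed, the equality `B₃2α₀′L^{−2n}(Lⁿξ)² = 2B₃α₀′ξ²`
being the schema's `B12Eq117Membership.eq117_scale` (reused BY NAME); «for α₀′ sufficiently small» = the explicit threshold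
`2B₃α₀′ ≤ α₀` of the schema.  PROVED: `condIV_of_prop9Shape` ((1.17) ⇒ (iv)); `satisfies_of_prop9Shape` / `mem_space_of_prop9Shape` /
`setOf_satisfiesI_III_subset_space` ((i)–(iii) with `α₀′ ≤ α₀, α₁′ ≤ α₁, γ₀′ ≤ γ₀` + (1.17) ⇒ (i)–(iv), i.e. the «simple and natural
spaces contained in U^c_j(X, α₀, α₁)»); `ofBackground_mem_space'_of_prop9Shape` (the specialised pairs `(𝐔, 𝐉 = D^{ξ*}_𝐔ξ⁻²π Im ∂𝐔)`
with `|𝐉| < α₀′` belong to `U^c_j(X, α₀, α₁)`, `𝐉` = `B12Eq18Current.current π ξ 𝐔`, its `𝔤ᶜ`-valuedness by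
`B12Eq18Current.current_mem_gc`).  NOT here: Proposition 9 [15] itself (hypothesis shape), the minimal configurations `U_j` (last
sentence; data of [15]).  No `def`, no `Prop` placeholder, no new fact; axioms standard.  Unit `lit-balaban-p07` (Phase-2 seat p07
gen 6; TAKING line HOME/STATUS.md 2026-08-21T06:52:00Z; row B12.Eq1.17, owners r09/r20), HOME `run/shared/lean/pub/lit-balaban/`.
-/

namespace Literature.MathematicalPhysics.QuantumFieldTheory.Balaban1983to89.B12Eq117Concrete

open Literature.MathematicalPhysics.QuantumFieldTheory.Balaban1983to89
open Literature.MathematicalPhysics.QuantumFieldTheory.Balaban1983to89.B12RegularSpaces111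
open Literature.MathematicalPhysics.QuantumFieldTheory.Balaban1983to89.B12RegularSpaces111Mono

noncomputable section

variable {P : Params} {i : ℕ} {𝔸 : Type*} [NormedRing 𝔸] [NormedAlgebra ℂ 𝔸] [CompleteSpace 𝔸]
variable (𝓜 : Model 𝔸)

/-! ## §1. (1.17) ⇒ condition (iv), «for α₀′ sufficiently small» = `2B₃α₀′ ≤ α₀` -/

omit [NormedAlgebra ℂ 𝔸] [CompleteSpace 𝔸] in
/-- **(1.17) ⇒ (iv).**  If the (iv)-data of a configuration `V` satisfy the printed (1.17) — `|∂U_n(M˙(V)) − 1| < B₃2α₀′L^{−2n}(Lⁿξ)²`,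
`|J_n(M˙(V))| < B₃2α₀′(Lⁿξ)²` on `X̃⁻²`, `n = 1, …, j` — and `2B₃α₀′ ≤ α₀` («for α₀′ sufficiently small»), `L ≠ 0`, then `V` satisfies
condition (iv) (1.16) with `α₀` (the printed equality `B₃2α₀′L^{−2n}(Lⁿξ)² = 2B₃α₀′ξ²` is `B12Eq117Membership.eq117_scale`).
[cite: Balaban1987RG1, (1.17) p.263] -/
theorem condIV_of_prop9Shape {bg : BackgroundFns P i 𝔸} {X₂ : Region P i} {c : StepConsts} (hL : c.L ≠ 0) {B₃ α₀' α₀ : ℝ}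
    (hsmall : 2 * B₃ * α₀' ≤ α₀) {V : PBond P i → 𝔸ˣ}
    (h117 : ∀ n, 1 ≤ n → n ≤ c.j →
      (∀ p ∈ X₂.plaqs, ‖(↑(plaq (bg.Un n V) p) : 𝔸) - 1‖ < B₃ * (2 * α₀') * (c.L ^ n)⁻¹ ^ 2 * (c.L ^ n * c.ξ) ^ 2) ∧
      (∀ b ∈ X₂.bonds, ‖bg.Jn n V b‖ < B₃ * (2 * α₀') * (c.L ^ n * c.ξ) ^ 2)) :
    CondIV bg X₂ c α₀ V := by
  refine ⟨fun n hn1 hnj p hp => ?_, fun n hn1 hnj b hb => ?_⟩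
  · have h := (h117 n hn1 hnj).1 p hp
    rw [B12Eq117Membership.eq117_scale B₃ α₀' c.L c.ξ hL n] at h
    exact h.trans_le (mul_le_mul_of_nonneg_right hsmall (sq_nonneg _))
  · have h := (h117 n hn1 hnj).2 b hb
    refine h.trans_le ?_
    calc B₃ * (2 * α₀') * (c.L ^ n * c.ξ) ^ 2 = 2 * B₃ * α₀' * (c.L ^ n * c.ξ) ^ 2 := by ring
      _ ≤ α₀ * (c.L ^ n * c.ξ) ^ 2 := mul_le_mul_of_nonneg_right hsmall (sq_nonneg _)

/-! ## §2. «some simple and natural spaces contained in U^c_j(X, α₀, α₁)»: (i)–(iii) with smaller constants + (1.17) -/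

/-- **The membership paragraph of p. 263 on the concrete space.**  Let `(𝐔, 𝐉)` satisfy (i)–(iii) with constants `(α₀′, α₁′, γ₀′)`,
`α₀′ ≤ α₀`, `α₁′ ≤ α₁`, `γ₀′ ≤ γ₀` («obviously these three conditions are satisfied in the original formulation»; `O(1)LMB ≥ 0`), and let
the output (1.17) of Proposition 9 [15] hold on the (iv)-data of every configuration `V` with `|∂V − 1| < α₀′ξ²` on `X` (so for `𝐔` by
(iii) and for the `G`-valued factor `U` by (1.11): «the same bounds hold for U instead of 𝐔»), with `2B₃α₀′ ≤ α₀`, `L ≠ 0`.  Then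
`(𝐔, 𝐉)` satisfies (i)–(iv) with `(α₀, α₁, γ₀)`. [cite: Balaban1987RG1, (1.17) p.263] -/
theorem satisfies_of_prop9Shape {F : Frame P i 𝔸} {c : StepConsts} (hcB : 0 ≤ c.cB) (hL : c.L ≠ 0)
    {B₃ α₀' α₁' γ₀' α₀ α₁ γ₀ : ℝ} (h₀ : α₀' ≤ α₀) (h₁ : α₁' ≤ α₁) (hγ : γ₀' ≤ γ₀) (hsmall : 2 * B₃ * α₀' ≤ α₀)
    (h117 : ∀ V : PBond P i → 𝔸ˣ, (∀ p ∈ F.X.plaqs, ‖(↑(plaq V p) : 𝔸) - 1‖ < α₀' * c.ξ ^ 2) → ∀ n, 1 ≤ n → n ≤ c.j →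
      (∀ p ∈ F.X₂.plaqs, ‖(↑(plaq (F.bg.Un n V) p) : 𝔸) - 1‖ < B₃ * (2 * α₀') * (c.L ^ n)⁻¹ ^ 2 * (c.L ^ n * c.ξ) ^ 2) ∧
      (∀ b ∈ F.X₂.bonds, ‖F.bg.Jn n V b‖ < B₃ * (2 * α₀') * (c.L ^ n * c.ξ) ^ 2))
    {Φ : FieldPair P i 𝔸ˣ 𝔸} (h : SatisfiesI_III 𝓜 F c α₀' α₁' γ₀' Φ) : Satisfies 𝓜 F c α₀ α₁ γ₀ Φ := by
  obtain ⟨hGc, hgc, U, A', hf, hI, hII, hIII⟩ := h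
  exact ⟨hGc, hgc, U, A', hf, condI_mono hcB h₀ hI, condII_mono h₁ hII, condIII_mono h₀ hγ hIII,
    condIV_of_prop9Shape hL hsmall (h117 Φ.U hIII.plaq_lt), condIV_of_prop9Shape hL hsmall (h117 U hI.plaq_lt)⟩

/-- **«thus the configuration (𝐔, 𝐉) belongs to the space U^c_j(X, α₀, α₁)»** (its own orbit) — under the hypotheses of
`satisfies_of_prop9Shape`. [cite: Balaban1987RG1, (1.17) p.263] -/
theorem mem_space_of_prop9Shape {F : Frame P i 𝔸} {c : StepConsts} (hcB : 0 ≤ c.cB) (hL : c.L ≠ 0)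
    {B₃ α₀' α₁' γ₀' α₀ α₁ γ₀ : ℝ} (h₀ : α₀' ≤ α₀) (h₁ : α₁' ≤ α₁) (hγ : γ₀' ≤ γ₀) (hsmall : 2 * B₃ * α₀' ≤ α₀)
    (h117 : ∀ V : PBond P i → 𝔸ˣ, (∀ p ∈ F.X.plaqs, ‖(↑(plaq V p) : 𝔸) - 1‖ < α₀' * c.ξ ^ 2) → ∀ n, 1 ≤ n → n ≤ c.j →
      (∀ p ∈ F.X₂.plaqs, ‖(↑(plaq (F.bg.Un n V) p) : 𝔸) - 1‖ < B₃ * (2 * α₀') * (c.L ^ n)⁻¹ ^ 2 * (c.L ^ n * c.ξ) ^ 2) ∧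
      (∀ b ∈ F.X₂.bonds, ‖F.bg.Jn n V b‖ < B₃ * (2 * α₀') * (c.L ^ n * c.ξ) ^ 2))
    {Φ : FieldPair P i 𝔸ˣ 𝔸} (h : SatisfiesI_III 𝓜 F c α₀' α₁' γ₀' Φ) : Φ ∈ space 𝓜 F c α₀ α₁ γ₀ :=
  mem_space_of_satisfies (satisfies_of_prop9Shape 𝓜 hcB hL h₀ h₁ hγ hsmall h117 h)

/-- **«there are some simple and natural spaces contained in U^c_j(X, α₀, α₁)»**: the set of pairs satisfying (i)–(iii) with the
smaller constants `(α₀′, α₁′, γ₀′)` is contained in `U^c_j(X, α₀, α₁, γ₀)`, given (1.17) on the (iv)-data and `2B₃α₀′ ≤ α₀`.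
[cite: Balaban1987RG1, (1.17) p.263] -/
theorem setOf_satisfiesI_III_subset_space {F : Frame P i 𝔸} {c : StepConsts} (hcB : 0 ≤ c.cB) (hL : c.L ≠ 0)
    {B₃ α₀' α₁' γ₀' α₀ α₁ γ₀ : ℝ} (h₀ : α₀' ≤ α₀) (h₁ : α₁' ≤ α₁) (hγ : γ₀' ≤ γ₀) (hsmall : 2 * B₃ * α₀' ≤ α₀)
    (h117 : ∀ V : PBond P i → 𝔸ˣ, (∀ p ∈ F.X.plaqs, ‖(↑(plaq V p) : 𝔸) - 1‖ < α₀' * c.ξ ^ 2) → ∀ n, 1 ≤ n → n ≤ c.j →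
      (∀ p ∈ F.X₂.plaqs, ‖(↑(plaq (F.bg.Un n V) p) : 𝔸) - 1‖ < B₃ * (2 * α₀') * (c.L ^ n)⁻¹ ^ 2 * (c.L ^ n * c.ξ) ^ 2) ∧
      (∀ b ∈ F.X₂.bonds, ‖F.bg.Jn n V b‖ < B₃ * (2 * α₀') * (c.L ^ n * c.ξ) ^ 2)) :
    {Φ | SatisfiesI_III 𝓜 F c α₀' α₁' γ₀' Φ} ⊆ space 𝓜 F c α₀ α₁ γ₀ :=
  fun _ h => mem_space_of_prop9Shape 𝓜 hcB hL h₀ h₁ hγ hsmall h117 h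

/-! ## §3. The specialisation `𝐉 = D^{ξ*}_𝐔 ξ⁻²π Im ∂𝐔` with `|𝐉| < α₀′`: the pairs `(𝐔, J(𝐔))` of (1.9) -/

/-- **«We specialize this example even more … 𝐉 = D^{ξ*}_𝐔 ξ⁻²π Im ∂𝐔 satisfies the bound |𝐉| < α₀′ … Then the pairs (𝐔, 𝐉) belong
to U^c_j(X, α₀, α₁)»** with the concrete current (1.8): let `𝐔 = (exp iξA′)U` with `U` satisfying (i) with `α₀′`, `(U, A′)` satisfying
(ii) with `α₁′`, `|∂𝐔 − 1| < α₀′ξ²` on `X`, `𝐔` `Gᶜ`-valued (everywhere, so that `J(𝐔)` is `𝔤ᶜ`-valued: `π` with values in `𝔤ᶜ`, `𝔤ᶜ`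
`Ad(Gᶜ)`-stable — `B12Eq18Current.current_mem_gc`), `|J(𝐔)| < α₀′` on `X` for `J(𝐔) = B12Eq18Current.current π ξ 𝐔`; constants
`α₀′ ≤ α₀`, `α₁′ ≤ α₁`, `2B₃α₀′ ≤ α₀`, `O(1)LMB ≥ 0`, `L ≠ 0`; and (1.17) on the (iv)-data as in §2.  Then
`(𝐔, J(𝐔)) = B12Eq18Current.ofBackground π ξ 𝐔 ∈ U^c_j(X, α₀, α₁)` (`γ₀ = α₀`). [cite: Balaban1987RG1, (1.17) p.263] -/
theorem ofBackground_mem_space'_of_prop9Shape {F : Frame P i 𝔸} {c : StepConsts} (hcB : 0 ≤ c.cB) (hL : c.L ≠ 0)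
    {B₃ α₀' α₁' α₀ α₁ : ℝ} (h₀ : α₀' ≤ α₀) (h₁ : α₁' ≤ α₁) (hsmall : 2 * B₃ * α₀' ≤ α₀)
    (h117 : ∀ V : PBond P i → 𝔸ˣ, (∀ p ∈ F.X.plaqs, ‖(↑(plaq V p) : 𝔸) - 1‖ < α₀' * c.ξ ^ 2) → ∀ n, 1 ≤ n → n ≤ c.j →
      (∀ p ∈ F.X₂.plaqs, ‖(↑(plaq (F.bg.Un n V) p) : 𝔸) - 1‖ < B₃ * (2 * α₀') * (c.L ^ n)⁻¹ ^ 2 * (c.L ^ n * c.ξ) ^ 2) ∧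
      (∀ b ∈ F.X₂.bonds, ‖F.bg.Jn n V b‖ < B₃ * (2 * α₀') * (c.L ^ n * c.ξ) ^ 2))
    (π : 𝔸 →ₗ[ℂ] 𝔸) (hπ : ∀ X, π X ∈ 𝓜.gc) (hgc : ∀ g ∈ 𝓜.Gc, ∀ X ∈ 𝓜.gc, B9Eq39Adjoint.R g X ∈ 𝓜.gc)
    {Uc U : PBond P i → 𝔸ˣ} {A' : PBond P i → 𝔸} (hUc : ∀ b, Uc b ∈ 𝓜.Gc) (hf : Factors c Uc U A')
    (hI : CondI 𝓜 F c α₀' U) (hII : CondII 𝓜 F.X c α₁' U A')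
    (hplaq : ∀ p ∈ F.X.plaqs, ‖(↑(plaq Uc p) : 𝔸) - 1‖ < α₀' * c.ξ ^ 2)
    (hJ : ∀ b ∈ F.X.bonds, ‖B12Eq18Current.current π c.ξ Uc b‖ < α₀') :
    B12Eq18Current.ofBackground π c.ξ Uc ∈ space' 𝓜 F c α₀ α₁ := by
  have h3 : SatisfiesI_III 𝓜 F c α₀' α₁' α₀' (B12Eq18Current.ofBackground π c.ξ Uc) :=
    ⟨fun b _ => hUc b, fun b _ => B12Eq18Current.current_mem_gc 𝓜 π hπ hgc c.ξ hUc b, U, A', hf, hI, hII, ⟨hplaq, hJ⟩⟩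
  exact mem_space_of_prop9Shape 𝓜 hcB hL h₀ h₁ h₀ hsmall h117 h3

end

end Literature.MathematicalPhysics.QuantumFieldTheory.Balaban1983to89.B12Eq117Concrete
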